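import Summits.Ventures.PercRepro.C041ZonePortCaseVSum

/-!
# The zone port problem of THEOREM R: the terminal swap, and CASE (v) for a gate zone of type `{2}` (p6, gen 24)

Setting of `C041ZonePortCaseVSum`.  Exchanging the two terminals (`swap`: every 1-edge becomes a 2-edge and
conversely; graph, root set, zones, vertices unchanged) exchanges `A₁ ↔ A₂`, `X₁ ↔ X₂`, `Good₁ ↔ Good₂`, keeps
admissibility and the weights, hence `Φ∨`, `Φ∧` (`phiOr_swap`, `phiAnd_swap`), and commutes with the sub-problem
(`swap_sub`, definitionally).  The case-(v) inequality for a unique switchable gate zone carrying a single 2-edge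
(`phiOr_sub_le'`, `phiAnd_sub_le'`) is the swap of the single-1-edge case.
-/

namespace PercRepro

namespace ZonePort

namespace Problem

open Finset

variable {V E : Type*}

/-- The terminal swap: every 1-edge becomes a 2-edge and conversely. -/
def swap (P : Problem V E) : Problem V E where
  adj := P.adj
  symm := P.symm
  root := P.root
  Z := P.Z
  hdisj := P.hdisj
  hroot := P.hroot
  hzconn := P.hzconn
  tv := P.tv
  ts e := !P.ts e
  tz := P.tz
  htv := P.htv
  sw := P.sw
  hk := P.hk

variable {P : Problem V E}

/-- A term of `P` is a term of its swap (the same edge). -/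
def swapTerm (P : Problem V E) (e : P.Term) : P.swap.Term := ⟨e.1, e.2⟩

/-- A term of the swap is a term of `P`. -/
def unswapTerm (P : Problem V E) (e : P.swap.Term) : P.Term := ⟨e.1, e.2⟩

/-- The swapped pattern: the same colours on the same edges. -/
def swapPattern (P : Problem V E) (x : P.Term → Bool) : P.swap.Term → Bool :=
  fun e => x (P.unswapTerm e)

/-- The swapped pattern on a swapped term. -/
@[simp] theorem swapPattern_apply (x : P.Term → Bool) (e : P.Term) : P.swapPattern x (P.swapTerm e) = x e := rfl

/-- The edge of a swapped term. -/
@[simp] theorem swapTerm_val (e : P.Term) : (P.swapTerm e).1 = e.1 := rfl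

/-- The edge of an unswapped term. -/
@[simp] theorem unswapTerm_val (e : P.swap.Term) : (P.unswapTerm e).1 = e.1 := rfl

/-- The side after the swap. -/
@[simp] theorem swap_ts (e : E) : P.swap.ts e = !P.ts e := rfl

/-- The zone of an edge is unchanged by the swap. -/
@[simp] theorem swap_tz (e : E) : P.swap.tz e = P.tz e := rfl

/-- The vertex of an edge is unchanged by the swap. -/
@[simp] theorem swap_tv (e : E) : P.swap.tv e = P.tv e := rfl

/-- Reachability is unchanged by the swap. -/
theorem reach_swap (A : Set V) (u v : V) : P.swap.Reach A u v ↔ P.Reach A u v := Iff.rfl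

/-- Reachability from the root set is unchanged by the swap. -/
theorem rreach_swap (A : Set V) (v : V) : P.swap.RReach A v ↔ P.RReach A v := Iff.rfl

/-- The gates are unchanged by the swap. -/
theorem isGate_swap (C : Finset V) : P.swap.IsGate C ↔ P.IsGate C := Iff.rfl

/-- The swap exchanges the deleted sets. -/
theorem A₁_swap (x : P.Term → Bool) : P.swap.A₁ (P.swapPattern x) = P.A₂ x := by
  ext v
  constructor
  · rintro ⟨e, he, hxe, hve⟩
    refine ⟨P.unswapTerm e, ?_, hxe, hve⟩
    simpa using he
  · rintro ⟨e, he, hxe, hve⟩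
    refine ⟨P.swapTerm e, ?_, hxe, hve⟩
    simp [swapTerm, he]

/-- The swap exchanges the deleted sets. -/
theorem A₂_swap (x : P.Term → Bool) : P.swap.A₂ (P.swapPattern x) = P.A₁ x := by
  ext v
  constructor
  · rintro ⟨e, he, hxe, hve⟩
    refine ⟨P.unswapTerm e, ?_, hxe, hve⟩
    simpa using he
  · rintro ⟨e, he, hxe, hve⟩
    refine ⟨P.swapTerm e, ?_, hxe, hve⟩
    simp [swapTerm, he]

/-- The swap exchanges `X₁` and `X₂`. -/
theorem X₁_swap (x : P.Term → Bool) : P.swap.X₁ (P.swapPattern x) ↔ P.X₂ x := by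
  constructor
  · rintro ⟨e, he, hxe⟩
    exact ⟨P.unswapTerm e, by simpa using he, hxe⟩
  · rintro ⟨e, he, hxe⟩
    exact ⟨P.swapTerm e, by simp [swapTerm, he], hxe⟩

/-- The swap exchanges `X₁` and `X₂`. -/
theorem X₂_swap (x : P.Term → Bool) : P.swap.X₂ (P.swapPattern x) ↔ P.X₁ x := by
  constructor
  · rintro ⟨e, he, hxe⟩
    exact ⟨P.unswapTerm e, by simpa using he, hxe⟩
  · rintro ⟨e, he, hxe⟩
    exact ⟨P.swapTerm e, by simp [swapTerm, he], hxe⟩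

/-- The swap exchanges `Good₁` and `Good₂`. -/
theorem good₁_swap (x : P.Term → Bool) : P.swap.Good₁ (P.swapPattern x) ↔ P.Good₂ x := by
  unfold Good₁ Good₂
  rw [A₁_swap]
  constructor
  · rintro ⟨e, he, hxe, hr⟩
    exact ⟨P.unswapTerm e, by simpa using he, hxe, hr⟩
  · rintro ⟨e, he, hxe, hr⟩
    exact ⟨P.swapTerm e, by simp [swapTerm, he], hxe, hr⟩

/-- The swap exchanges `Good₁` and `Good₂`. -/
theorem good₂_swap (x : P.Term → Bool) : P.swap.Good₂ (P.swapPattern x) ↔ P.Good₁ x := by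
  unfold Good₁ Good₂
  rw [A₂_swap]
  constructor
  · rintro ⟨e, he, hxe, hr⟩
    exact ⟨P.unswapTerm e, by simpa using he, hxe, hr⟩
  · rintro ⟨e, he, hxe, hr⟩
    exact ⟨P.swapTerm e, by simp [swapTerm, he], hxe, hr⟩

/-- Admissibility is unchanged by the swap. -/
theorem adm_swap (x : P.Term → Bool) : P.swap.Adm (P.swapPattern x) ↔ P.Adm x := by
  constructor
  · rintro ⟨h1, h2⟩
    refine ⟨fun e he => h1 (P.swapTerm e) he, fun e f hef he hf => ?_⟩
    have := h2 (P.swapTerm f) (P.swapTerm e) hef.symm (by simp [swapTerm, hf]) (by simp [swapTerm, he])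
    exact this.symm
  · rintro ⟨h1, h2⟩
    refine ⟨fun e he => h1 (P.unswapTerm e) he, fun e f hef he hf => ?_⟩
    have := h2 (P.unswapTerm f) (P.unswapTerm e) hef.symm (by simpa using hf) (by simpa using he)
    exact this.symm

open Classical in
/-- The weight is unchanged by the swap. -/
theorem weight_swap (x : P.Term → Bool) : P.swap.weight (P.swapPattern x) = P.weight x := by
  unfold weight
  rw [if_congr (good₁_swap x) rfl rfl, if_congr (good₂_swap x) rfl rfl]
  ring

/-- The swapped patterns, as an equivalence. -/
def swapPatternEquiv (P : Problem V E) : (P.Term → Bool) ≃ (P.swap.Term → Bool) where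
  toFun := P.swapPattern
  invFun y := fun e => y (P.swapTerm e)
  left_inv _ := rfl
  right_inv _ := rfl

/-- The swapped-pattern equivalence, applied. -/
theorem swapPatternEquiv_apply (x : P.Term → Bool) : P.swapPatternEquiv x = P.swapPattern x := rfl

/-- The swap commutes with the sub-problem. -/
theorem swap_sub [DecidableEq V] (C : Finset V) (hC : C ∈ P.Z) : P.swap.sub C hC = (P.sub C hC).swap := rfl

/-- Pure types are exchanged by the swap. -/
theorem pure₁_swap (C : Finset V) : P.swap.Pure₁ C ↔ P.Pure₂ C := by
  constructor
  · intro h f hf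
    have := h (P.swapTerm f) hf
    simpa [swapTerm] using this
  · intro h f hf
    have := h (P.unswapTerm f) hf
    simpa using this

section Sums

variable [Fintype E] [DecidableEq E] [DecidableEq V]

open Classical in
/-- `Φ∨` is unchanged by the swap. -/
theorem phiOr_swap : P.swap.phiOr = P.phiOr := by
  unfold phiOr
  rw [← P.swapPatternEquiv.sum_comp]
  apply Finset.sum_congr rfl
  intro x _
  rw [swapPatternEquiv_apply, if_congr (and_congr (adm_swap x) ((or_congr (X₁_swap x) (X₂_swap x)).trans or_comm))
    (weight_swap x) rfl]

open Classical in
/-- `Φ∧` is unchanged by the swap. -/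
theorem phiAnd_swap : P.swap.phiAnd = P.phiAnd := by
  unfold phiAnd
  rw [← P.swapPatternEquiv.sum_comp]
  apply Finset.sum_congr rfl
  intro x _
  rw [swapPatternEquiv_apply, if_congr (and_congr (adm_swap x) ((and_congr (X₁_swap x) (X₂_swap x)).trans and_comm))
    (weight_swap x) rfl]

/-- **CASE (v), `Φ∨`, a unique switchable gate zone carrying a single 2-edge**: `Φ∨ (P.sub C) ≤ Φ∨ P`. -/
theorem phiOr_sub_le' {C : Finset V} (hC : P.IsGate C) (huniq : ∀ D, P.IsGate D → D = C) {e₀ : P.Term}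
    (he₀ : P.tz e₀.1 = C) (hs₀ : P.ts e₀.1 = true) (huniqT : ∀ f : P.Term, P.tz f.1 = C → f = e₀)
    (hsw : P.sw C = true) : (P.sub C hC.mem).phiOr ≤ P.phiOr := by
  have h := phiOr_sub_le (P := P.swap) (C := C) hC huniq (e₀ := P.swapTerm e₀) he₀ (by simp [swapTerm, hs₀])
    (fun f hf => by
      have := huniqT (P.unswapTerm f) hf
      exact Subtype.ext (congrArg Subtype.val this)) hsw
  rw [swap_sub, phiOr_swap, phiOr_swap] at h
  exact h

/-- **CASE (v), `Φ∧`, a unique switchable gate zone carrying a single 2-edge**: `Φ∧ (P.sub C) ≤ Φ∧ P`. -/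
theorem phiAnd_sub_le' {C : Finset V} (hC : P.IsGate C) (huniq : ∀ D, P.IsGate D → D = C) {e₀ : P.Term}
    (he₀ : P.tz e₀.1 = C) (hs₀ : P.ts e₀.1 = true) (huniqT : ∀ f : P.Term, P.tz f.1 = C → f = e₀)
    (hsw : P.sw C = true) : (P.sub C hC.mem).phiAnd ≤ P.phiAnd := by
  have h := phiAnd_sub_le (P := P.swap) (C := C) hC huniq (e₀ := P.swapTerm e₀) he₀ (by simp [swapTerm, hs₀])
    (fun f hf => by
      have := huniqT (P.unswapTerm f) hf
      exact Subtype.ext (congrArg Subtype.val this)) hsw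
  rw [swap_sub, phiAnd_swap, phiAnd_swap] at h
  exact h

end Sums

end Problem

end ZonePort

end PercRepro
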